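import Mathlib
import HarnessLib
import Summits.ValiantsHypothesis.ValiantsHypothesis.Theses.MonotoneRestoration
import Literature.Computability.AlgebraicComplexity.ArithCircuit
import Literature.Computability.AlgebraicComplexity.ArithCircuitProofs
import Literature.Computability.AlgebraicComplexity.MonotoneStructure
import Literature.Computability.AlgebraicComplexity.PermanentIrreducible
import Literature.ModelTheory.FiniteModelTheory.CkEquiv
import Summits.ValiantsHypothesis.ValiantsHypothesis.Theorems.MonotoneRestorationMonotoneRestorationQPCosetCount
import Summits.ValiantsHypothesis.ValiantsHypothesis.Theorems.MonotoneRestorationMonotoneRestorationQPSymmetricLB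
import Summits.ValiantsHypothesis.ValiantsHypothesis.Theorems.MonotoneRestorationMonotoneRestorationQPSupportSymmetrisation
import Summits.ValiantsHypothesis.ValiantsHypothesis.Theorems.MonotoneRestorationMonotoneRestorationQPSparseRegime
import Summits.ValiantsHypothesis.ValiantsHypothesis.Theorems.MonotoneRestorationMonotoneRestorationQPBeta
import Literature.Computability.AlgebraicComplexity.SymmetricArithCircuit
import Literature.Computability.AlgebraicComplexity.DawarWilsenach2025Proofs
import Literature.GroupTheory.PermutationGroups.SmallIndexSubgroups
import Summits.ValiantsHypothesis.ValiantsHypothesis.Theorems.MonotoneRestorationQP.Negative.LoadBearing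
import Summits.ValiantsHypothesis.ValiantsHypothesis.Theorems.MonotoneRestorationMonotoneRestorationQPPermSupportCount

/-! TTRL-lite variant V22065 of stmt-ValiantsHypothesis-15886 -/

-- `ValiantsHypothesis.ValiantsHypothesis`: the D-0017 layout repeats the problem name in the path.
set_option linter.dupNamespace false

namespace Summit.ValiantsHypothesis.ValiantsHypothesis.Theorems

open Summit.ValiantsHypothesis.ValiantsHypothesis.Theses.MonotoneRestoration
open Literature.Computability.AlgebraicComplexity

/-- TTRL-lite variant V22065 of the registered stub `stub_gammaArithmetic` of
`stmt-ValiantsHypothesis-15886` (analytic half with an explicit threshold of order `c · log₂ t`):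
if `2 c (log₂ t + 2) + 3 ≤ t` then `2 ^ (2 c + 3) · t ^ (2 c) ≤ 2 ^ t`.  Proof: with
`L := Nat.log 2 t` one has `t < 2 ^ (L + 1)` (`Nat.lt_pow_succ_log_self`), hence
`t ^ (2 c) ≤ 2 ^ ((L + 1) · 2 c)` and the left-hand side is at most
`2 ^ (2 c (L + 2) + 3) ≤ 2 ^ t` by the hypothesis. [folklore] -/
theorem stub_gammaArithmetic_var22065 :
    ∀ (c t : ℕ), 2 * c * (Nat.log 2 t + 2) + 3 ≤ t → 2 ^ (2 * c + 3) * t ^ (2 * c) ≤ 2 ^ t := by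
  intro c t h
  have ht : t < 2 ^ (Nat.log 2 t + 1) := Nat.lt_pow_succ_log_self (by norm_num) t
  have h1 : t ^ (2 * c) ≤ 2 ^ ((Nat.log 2 t + 1) * (2 * c)) :=
    (Nat.pow_le_pow_left ht.le _).trans_eq (pow_mul 2 (Nat.log 2 t + 1) (2 * c)).symm
  calc 2 ^ (2 * c + 3) * t ^ (2 * c)
      ≤ 2 ^ (2 * c + 3) * 2 ^ ((Nat.log 2 t + 1) * (2 * c)) := Nat.mul_le_mul_left _ h1
    _ = 2 ^ (2 * c * (Nat.log 2 t + 2) + 3) := by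
        rw [← pow_add]
        congr 1
        ring
    _ ≤ 2 ^ t := Nat.pow_le_pow_right (by norm_num) h

end Summit.ValiantsHypothesis.ValiantsHypothesis.Theorems
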